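import Summits.RiemannHypothesis.RiemannHypothesis.Theorems.SemilocalNegCertElevenKinked129B
import HarnessLib

/-!
# Semi-local threshold of the `{∞,2,3,5,7,11}` form, negative side: `a*({2,…,11}) ≤ 165/128` from a KINKED (piecewise cubic) witness (part 3/4: the kernel facts piece 40 … piece 60)

Cell `rh-explicit` (HOME `run/shared/lean/pub/rh-explicit/`), seat cc-s2-4 gen8 (A4 SEMILOCAL-TABLE, kernel column; fourth instance of the
piecewise-witness layer `SemilocalPiecewise{Witness,Increment,IncrementSum,Cert}.lean` + `SemilocalArchDensityFar.lean`).  Honest framing: theorems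
about the tree's `weilSemilocalThreshold S`; nothing here bears on RH.  The instance is split into FOUR files (`…Kinked129`, `…129B`, `…129C`,
`…129Final`) of ≈ 21 kernel facts each; no data is trusted: 83 kernel facts (`decide +kernel`).

WHY KINKED (numbers, `HOME/cc-s2-4/gen8/KNEE-NOTE.md`): at `b = 165/128 = 1.2890625 = a*(S) + 0.0062` (`S = {2,3,5,7,11}`, DATA `a* = 1.2829`)
the polynomial class is still in its flat regime (degree 13: `+2e-12` at 1.288; the tree's row is `13/10` at degree 9, `SemilocalNegCertEleven.lean`),
whereas an odd PIECEWISE CUBIC with breakpoints at ALL EIGHT atom images `|b − log n|`, `n = 4, 3, 5, 2, 7, 8, 9, 11` (rounded to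
`12, 24, 41, 76, 84, 101, 116, 142 /128`), gives `Re Q_S(G)/‖G‖² = −3.55·10⁻³` (form without the polar credit; with only four of the eight kinks the
value collapses to −6·10⁻⁶ — every atom's kink is used).  Instance data: `N = 15` (atom table `atomsEleven`, `atomsEnclose_Eleven`), 9 pieces of
degree ≤ 3, 81 `t`-pieces, atoms `2, 3, 4, 5, 7, 8, 9, 11` in the pieces `34, 50, 61, 68, 75, 77, 78, 79`; kernel margin `(rhs − lhs)/‖G‖² = 3.55·10⁻³`.
⇒ **`weilSemilocalThreshold {2,3,5,7,11} ≤ 165/128 < 1.2891`** and for the class `2, 3, 5, 7, 11 ∈ S ∌ 13`: `a*(S) ∈ [(log 5)/2, 165/128]`.  Folklore.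
-/

set_option autoImplicit false
set_option linter.dupNamespace false  -- the mandated namespace repeats `RiemannHypothesis`
set_option Elab.async false  -- serialise the kernel facts: in parallel they exhaust the node's per-process heap (cc-s2-4 gen11, CC4-LEAN §16.10)

noncomputable section

open Complex Filter Set MeasureTheory Topology
open scoped Real

namespace Summit.RiemannHypothesis.RiemannHypothesis.Theorems.SemilocalPolyWitness

open MeasureTheory Set Finset Real
open Literature.NumberTheory.LFunctions
open Summit.RiemannHypothesis.RiemannHypothesis.Theorems.MotivicDoor
open Summit.RiemannHypothesis.RiemannHypothesis.Theorems.MotivicDoor.SemilocalThreshold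
open Summit.RiemannHypothesis.RiemannHypothesis.Theorems.MotivicDoor.SemilocalMarkov
open LQ

set_option maxHeartbeats 0 in
/-- kernel fact: piece `40` of `certElevenKinked129`. -/
theorem check_ElevenKinked129_piece40 : certElevenKinked129.checkPiecePW 40 = true := by
  decide +kernel

set_option maxHeartbeats 0 in
/-- kernel fact: piece `41` of `certElevenKinked129`. -/
theorem check_ElevenKinked129_piece41 : certElevenKinked129.checkPiecePW 41 = true := by
  decide +kernel

set_option maxHeartbeats 0 in
/-- kernel fact: piece `42` of `certElevenKinked129`. -/
theorem check_ElevenKinked129_piece42 : certElevenKinked129.checkPiecePW 42 = true := by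
  decide +kernel

set_option maxHeartbeats 0 in
/-- kernel fact: piece `43` of `certElevenKinked129`. -/
theorem check_ElevenKinked129_piece43 : certElevenKinked129.checkPiecePW 43 = true := by
  decide +kernel

set_option maxHeartbeats 0 in
/-- kernel fact: piece `44` of `certElevenKinked129`. -/
theorem check_ElevenKinked129_piece44 : certElevenKinked129.checkPiecePW 44 = true := by
  decide +kernel

set_option maxHeartbeats 0 in
/-- kernel fact: piece `45` of `certElevenKinked129`. -/
theorem check_ElevenKinked129_piece45 : certElevenKinked129.checkPiecePW 45 = true := by
  decide +kernel

set_option maxHeartbeats 0 in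
/-- kernel fact: piece `46` of `certElevenKinked129`. -/
theorem check_ElevenKinked129_piece46 : certElevenKinked129.checkPiecePW 46 = true := by
  decide +kernel

set_option maxHeartbeats 0 in
/-- kernel fact: piece `47` of `certElevenKinked129`. -/
theorem check_ElevenKinked129_piece47 : certElevenKinked129.checkPiecePW 47 = true := by
  decide +kernel

set_option maxHeartbeats 0 in
/-- kernel fact: piece `48` of `certElevenKinked129`. -/
theorem check_ElevenKinked129_piece48 : certElevenKinked129.checkPiecePW 48 = true := by
  decide +kernel

set_option maxHeartbeats 0 in
/-- kernel fact: piece `49` of `certElevenKinked129`. -/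
theorem check_ElevenKinked129_piece49 : certElevenKinked129.checkPiecePW 49 = true := by
  decide +kernel

set_option maxHeartbeats 0 in
/-- kernel fact: piece `50` of `certElevenKinked129`. -/
theorem check_ElevenKinked129_piece50 : certElevenKinked129.checkPiecePW 50 = true := by
  decide +kernel

set_option maxHeartbeats 0 in
/-- kernel fact: piece `51` of `certElevenKinked129`. -/
theorem check_ElevenKinked129_piece51 : certElevenKinked129.checkPiecePW 51 = true := by
  decide +kernel

set_option maxHeartbeats 0 in
/-- kernel fact: piece `52` of `certElevenKinked129`. -/
theorem check_ElevenKinked129_piece52 : certElevenKinked129.checkPiecePW 52 = true := by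
  decide +kernel

set_option maxHeartbeats 0 in
/-- kernel fact: piece `53` of `certElevenKinked129`. -/
theorem check_ElevenKinked129_piece53 : certElevenKinked129.checkPiecePW 53 = true := by
  decide +kernel

set_option maxHeartbeats 0 in
/-- kernel fact: piece `54` of `certElevenKinked129`. -/
theorem check_ElevenKinked129_piece54 : certElevenKinked129.checkPiecePW 54 = true := by
  decide +kernel

set_option maxHeartbeats 0 in
/-- kernel fact: piece `55` of `certElevenKinked129`. -/
theorem check_ElevenKinked129_piece55 : certElevenKinked129.checkPiecePW 55 = true := by
  decide +kernel

set_option maxHeartbeats 0 in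
/-- kernel fact: piece `56` of `certElevenKinked129`. -/
theorem check_ElevenKinked129_piece56 : certElevenKinked129.checkPiecePW 56 = true := by
  decide +kernel

set_option maxHeartbeats 0 in
/-- kernel fact: piece `57` of `certElevenKinked129`. -/
theorem check_ElevenKinked129_piece57 : certElevenKinked129.checkPiecePW 57 = true := by
  decide +kernel

set_option maxHeartbeats 0 in
/-- kernel fact: piece `58` of `certElevenKinked129`. -/
theorem check_ElevenKinked129_piece58 : certElevenKinked129.checkPiecePW 58 = true := by
  decide +kernel

set_option maxHeartbeats 0 in
/-- kernel fact: piece `59` of `certElevenKinked129`. -/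
theorem check_ElevenKinked129_piece59 : certElevenKinked129.checkPiecePW 59 = true := by
  decide +kernel

set_option maxHeartbeats 0 in
/-- kernel fact: piece `60` of `certElevenKinked129`. -/
theorem check_ElevenKinked129_piece60 : certElevenKinked129.checkPiecePW 60 = true := by
  decide +kernel

end Summit.RiemannHypothesis.RiemannHypothesis.Theorems.SemilocalPolyWitness

end
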